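import Mathlib
import HarnessLib
import Literature.Analysis.ValidatedNumerics.IntervalTotalStepIteration
import Literature.Analysis.ValidatedNumerics.IntervalIterationWithIntersection
import Literature.Analysis.ValidatedNumerics.IntervalFixedPointTheorems

/-!
# Newton-like interval iterations without inversion of interval matrices (Alefeld–Herzberger, Ch. 19, Thms 1, 2)

Source: G. Alefeld, J. Herzberger, *Introduction to Interval Computations*, Academic Press 1983, Ch. 19
("Newton-like methods"), pp. 222–229: the representation (3) `f(x) = 𝓙(x)(x − y)` of `f` about its zero
`y`, the iteration method (7), **Theorem 1** with (8), (9) and its proof, the remark after the proof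
(`m(x⁽ᵏ⁾) ∉ x⁽ᵏ⁺¹⁾` whenever `m(x⁽ᵏ⁾) ≠ y`), the method (12) with step-dependent interval matrices `𝓥⁽ᵏ⁾`
and **Theorem 2**, parts (8), (9), together with the first two lines of the estimate in the proof of (13).

Setting (pp. 222–225).  `f` has a zero `y` in the interval vector `x⁽⁰⁾`; for `x ∈ x⁽⁰⁾` the mean-value
representation (3) `f(x) = 𝓙(x)(x − y)` holds with a nonsingular matrix `𝓙(x)`, and `𝓥` (resp. `𝓥⁽ᵏ⁾`) is
an interval matrix containing the inverses `𝓙(x)⁻¹`.  The methods are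

  (7)  `x⁽ᵏ⁺¹⁾ = {m(x⁽ᵏ⁾) − 𝓥 f(m(x⁽ᵏ⁾))} ∩ x⁽ᵏ⁾`,      (12)  `x⁽ᵏ⁺¹⁾ = {m(x⁽ᵏ⁾) − 𝓥⁽ᵏ⁾ f(m(x⁽ᵏ⁾))} ∩ x⁽ᵏ⁾`,

`k ≥ 0`, with the midpoint vector `m(x)` of (18.1).

**Theorem 1.** (8) each `x⁽ᵏ⁾` contains `y`; (9) if each matrix `𝓥̃ ∈ 𝓥` is nonsingular then `lim x⁽ᵏ⁾ = y`.
**Theorem 2** for (12) (with `{𝓙(x)⁻¹} ⊆ 𝓥⁽ᵏ⁾ ⊆ 𝓥⁽⁰⁾`): (8) each `x⁽ᵏ⁾` contains `y`; (9) if every matrix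
`𝓥̃ ∈ 𝓥⁽⁰⁾` is nonsingular then `lim x⁽ᵏ⁾ = y`.

Proofs as printed.  (8): `y = m(x⁽ᵏ⁾) − 𝓙(m(x⁽ᵏ⁾))⁻¹f(m(x⁽ᵏ⁾)) ∈ m(x⁽ᵏ⁾) − 𝓥 f(m(x⁽ᵏ⁾))` by (10.10').
(9): the nested iterates converge (Cor. 10.8) to `x ∋ y`; by continuity of (7), `x ⊆ m(x) − 𝓥 f(m(x))`;
as `m(x) ∈ x`, `0 ∈ 𝓥 f(m(x))`, so by (10.1) `0 = 𝓥̃ f(m(x))` for some `𝓥̃ ∈ 𝓥`; `𝓥̃` is nonsingular,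
hence `f(m(x)) = 0` and, by (3), `m(x) = y`; then `x ⊆ m(x) − 𝓥·0 = y`.

The function `f` enters only through (3), its continuity and the data `𝓙`, `𝓥`; the interval vectors are
the pairs `(x̲, x̄)` of `IntervalTotalStepIteration` (`IVec n`), with `Incl`, `inter` of
`IntervalIterationWithIntersection` and `SeqLim`, Cor. 10.8 (`cor10_8`) and `interStep` of
`IntervalFixedPointTheorems`.

Honest scope.  NOT formalised: the derivation of (3)–(6) from Taylor expansions, the computation (10)–(11) of
the matrices `𝓥⁽ᵏ⁾`, the convergence-order statement (13) beyond its first estimate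
`d(x⁽ᵏ⁺¹⁾) ≤ d(𝓥⁽ᵏ⁾)|f(m(x⁽ᵏ⁾))|`, and the rest of Chapter 19 (Lemmas 3–6, Theorem 7).
-/

open Filter Topology

noncomputable section

namespace Literature.Analysis.ValidatedNumerics.NewtonLikeIntervalIteration

open Literature.Analysis.ValidatedNumerics.IntervalTotalStepIteration
open Literature.Analysis.ValidatedNumerics.IntervalIterationWithIntersection
open Literature.Analysis.ValidatedNumerics.IntervalFixedPointTheorems

variable {n : ℕ}

/-! ## §1 Points of interval vectors, the midpoint vector, interval matrices and the product `𝓥·v` -/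

/-- `t ∈ x` for a point vector `t` and an interval vector `x = [x̲, x̄]`.
[cite: AlefeldHerzberger1983, Ch. 10 Def 1] -/
def PMem (t : Fin n → ℝ) (x : IVec n) : Prop := ∀ i, x.1 i ≤ t i ∧ t i ≤ x.2 i

/-- `t ∈ x ⇔ [t, t] ⊆ x`. [cite: AlefeldHerzberger1983, Ch. 10 Def 1] -/
theorem pmem_iff_incl (t : Fin n → ℝ) (x : IVec n) : PMem t x ↔ Incl (t, t) x :=
  ⟨fun h i => ⟨(h i).1, (h i).2⟩, fun h i => ⟨(h i).1, (h i).2⟩⟩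

/-- An interval vector with a point in it is genuine. [cite: AlefeldHerzberger1983, Ch. 10 Def 1] -/
theorem isProper_of_pmem {t : Fin n → ℝ} {x : IVec n} (h : PMem t x) : IsProper x := fun i =>
  (h i).1.trans (h i).2

/-- [cite: AlefeldHerzberger1983, Ch. 10 Def 1] -/
theorem pmem_of_pmem_of_incl {t : Fin n → ℝ} {x y : IVec n} (h : PMem t x) (hxy : Incl x y) : PMem t y :=
  fun i => ⟨(hxy i).1.trans (h i).1, (h i).2.trans (hxy i).2⟩

/-- `t ∈ x ∩ z` from `t ∈ x`, `t ∈ z`. [cite: AlefeldHerzberger1983, Ch. 19 (7)] -/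
theorem pmem_inter {t : Fin n → ℝ} {x z : IVec n} (hx : PMem t x) (hz : PMem t z) : PMem t (inter x z) :=
  fun i => ⟨max_le (hx i).1 (hz i).1, le_min (hx i).2 (hz i).2⟩

/-- The midpoint vector (18.1): `m(x) = (½(x̲_i + x̄_i))`. [cite: AlefeldHerzberger1983, Ch. 18 (1); Ch. 19 (7)] -/
def vmid (x : IVec n) : Fin n → ℝ := fun i => (x.1 i + x.2 i) / 2

/-- [cite: AlefeldHerzberger1983, Ch. 18 (1)] -/
@[simp] theorem vmid_apply (x : IVec n) (i : Fin n) : vmid x i = (x.1 i + x.2 i) / 2 := rfl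

/-- `m(x) ∈ x`. [cite: AlefeldHerzberger1983, Ch. 18 (2)] -/
theorem vmid_pmem {x : IVec n} (hx : IsProper x) : PMem (vmid x) x := fun i => by
  have := hx i
  simp only [vmid_apply]
  constructor <;> linarith

/-- An interval matrix `𝓥 = [V̲, V̄]` as the pair of its bound matrices. [cite: AlefeldHerzberger1983, Ch. 10] -/
abbrev IMatF (n : ℕ) : Type := Matrix (Fin n) (Fin n) ℝ × Matrix (Fin n) (Fin n) ℝ

/-- `𝓥` is genuine: `V̲ ≤ V̄` entrywise. [cite: AlefeldHerzberger1983, Ch. 10] -/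
def MIsProper (V : IMatF n) : Prop := ∀ i j, V.1 i j ≤ V.2 i j

/-- `𝓟 ∈ 𝓥` for a point matrix `𝓟`. [cite: AlefeldHerzberger1983, Ch. 10] -/
def MMem (P : Matrix (Fin n) (Fin n) ℝ) (V : IMatF n) : Prop := ∀ i j, V.1 i j ≤ P i j ∧ P i j ≤ V.2 i j

/-- `𝓥 ⊆ 𝓦`. [cite: AlefeldHerzberger1983, Ch. 10] -/
def MIncl (V W : IMatF n) : Prop := ∀ i j, W.1 i j ≤ V.1 i j ∧ V.2 i j ≤ W.2 i j

/-- [cite: AlefeldHerzberger1983, Ch. 10] -/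
theorem mIsProper_of_mmem {P : Matrix (Fin n) (Fin n) ℝ} {V : IMatF n} (h : MMem P V) : MIsProper V :=
  fun i j => (h i j).1.trans (h i j).2

/-- [cite: AlefeldHerzberger1983, Ch. 10] -/
theorem mmem_of_mmem_of_mincl {P : Matrix (Fin n) (Fin n) ℝ} {V W : IMatF n} (h : MMem P V) (hVW : MIncl V W) :
    MMem P W := fun i j => ⟨(hVW i j).1.trans (h i j).1, (h i j).2.trans (hVW i j).2⟩

/-- The product `𝓥·v` of an interval matrix and a point vector: `(𝓥v)_i = Σ_j V_ij v_j`,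
`[a, b]·c = [min(ac, bc), max(ac, bc)]`. [cite: AlefeldHerzberger1983, Ch. 10 (matrix operations), Ch. 19 (7)] -/
def mulPV (V : IMatF n) (v : Fin n → ℝ) : IVec n :=
  (fun i => ∑ j, min (V.1 i j * v j) (V.2 i j * v j), fun i => ∑ j, max (V.1 i j * v j) (V.2 i j * v j))

/-- [cite: AlefeldHerzberger1983, Ch. 10] -/
@[simp] theorem mulPV_fst (V : IMatF n) (v : Fin n → ℝ) (i : Fin n) :
    (mulPV V v).1 i = ∑ j, min (V.1 i j * v j) (V.2 i j * v j) := rfl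

/-- [cite: AlefeldHerzberger1983, Ch. 10] -/
@[simp] theorem mulPV_snd (V : IMatF n) (v : Fin n → ℝ) (i : Fin n) :
    (mulPV V v).2 i = ∑ j, max (V.1 i j * v j) (V.2 i j * v j) := rfl

/-- [folklore] `p ∈ [lo, hi] ⇒ pb ∈ [min(lo b, hi b), max(lo b, hi b)]`. -/
private theorem mul_mem_minmax {lo hi p : ℝ} (h : lo ≤ p ∧ p ≤ hi) (b : ℝ) :
    min (lo * b) (hi * b) ≤ p * b ∧ p * b ≤ max (lo * b) (hi * b) := by
  rcases le_total 0 b with hb | hb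
  · exact ⟨(min_le_left _ _).trans (mul_le_mul_of_nonneg_right h.1 hb),
      (mul_le_mul_of_nonneg_right h.2 hb).trans (le_max_right _ _)⟩
  · exact ⟨(min_le_right _ _).trans (mul_le_mul_of_nonpos_right h.2 hb),
      (mul_le_mul_of_nonpos_right h.1 hb).trans (le_max_left _ _)⟩

/-- **(10.10')**: `𝓟 ∈ 𝓥 ⇒ 𝓟v ∈ 𝓥·v`. [cite: AlefeldHerzberger1983, Thm 10.5 (10.10')] -/
theorem mulVec_pmem_mulPV {P : Matrix (Fin n) (Fin n) ℝ} {V : IMatF n} (h : MMem P V) (v : Fin n → ℝ) :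
    PMem (P.mulVec v) (mulPV V v) := fun i => by
  simp only [mulPV_fst, mulPV_snd, Matrix.mulVec, dotProduct]
  exact ⟨Finset.sum_le_sum fun j _ => (mul_mem_minmax (h i j) _).1,
    Finset.sum_le_sum fun j _ => (mul_mem_minmax (h i j) _).2⟩

/-- Inclusion monotonicity in the matrix: `𝓥 ⊆ 𝓦 ⇒ 𝓥·v ⊆ 𝓦·v`. [cite: AlefeldHerzberger1983, Thm 10.5 (10')] -/
theorem mulPV_incl_of_mincl {V W : IMatF n} (h : MIncl V W) (hV : MIsProper V) (v : Fin n → ℝ) :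
    Incl (mulPV V v) (mulPV W v) := fun i => by
  simp only [mulPV_fst, mulPV_snd]
  refine ⟨Finset.sum_le_sum fun j _ => le_min ?_ ?_, Finset.sum_le_sum fun j _ => max_le ?_ ?_⟩
  · exact (mul_mem_minmax ⟨(h i j).1, (hV i j).trans (h i j).2⟩ _).1
  · exact (mul_mem_minmax ⟨(h i j).1.trans (hV i j), (h i j).2⟩ _).1
  · exact (mul_mem_minmax ⟨(h i j).1, (hV i j).trans (h i j).2⟩ _).2
  · exact (mul_mem_minmax ⟨(h i j).1.trans (hV i j), (h i j).2⟩ _).2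

/-- `𝓥·0 = 0`. [cite: AlefeldHerzberger1983, Ch. 10] -/
theorem mulPV_zero (V : IMatF n) : mulPV V 0 = (0, 0) := by
  refine Prod.ext (funext fun i => ?_) (funext fun i => ?_)
  · simp only [mulPV_fst, Pi.zero_apply, mul_zero, min_self, Finset.sum_const_zero]
  · simp only [mulPV_snd, Pi.zero_apply, mul_zero, max_self, Finset.sum_const_zero]

/-- **(10.12)**: `d(𝓥·v)_i = Σ_j d(V_ij)|v_j|`. [cite: AlefeldHerzberger1983, Def 10.6 (10.12)] -/
theorem width_mulPV {V : IMatF n} (hV : MIsProper V) (v : Fin n → ℝ) (i : Fin n) :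
    width (mulPV V v) i = ∑ j, (V.2 i j - V.1 i j) * |v j| := by
  simp only [width, mulPV_fst, mulPV_snd, ← Finset.sum_sub_distrib]
  refine Finset.sum_congr rfl fun j _ => ?_
  rw [max_sub_min_eq_abs', ← sub_mul, abs_mul, abs_of_nonpos (sub_nonpos.2 (hV i j))]
  ring

/-- `c − z = [c − z̄, c − z̲]` for a point vector `c`. [cite: AlefeldHerzberger1983, Ch. 10, Ch. 19 (7)] -/
def psubV (c : Fin n → ℝ) (z : IVec n) : IVec n := (c - z.2, c - z.1)

/-- [cite: AlefeldHerzberger1983, Ch. 10] -/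
@[simp] theorem psubV_fst (c : Fin n → ℝ) (z : IVec n) : (psubV c z).1 = c - z.2 := rfl

/-- [cite: AlefeldHerzberger1983, Ch. 10] -/
@[simp] theorem psubV_snd (c : Fin n → ℝ) (z : IVec n) : (psubV c z).2 = c - z.1 := rfl

/-- `t ∈ z ⇒ c − t ∈ c − z`. [cite: AlefeldHerzberger1983, Thm 10.5 (10')] -/
theorem sub_pmem_psubV {t : Fin n → ℝ} {z : IVec n} (h : PMem t z) (c : Fin n → ℝ) : PMem (c - t) (psubV c z) :=
  fun i => by
    simp only [psubV_fst, psubV_snd, Pi.sub_apply]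
    exact ⟨sub_le_sub le_rfl (h i).2, sub_le_sub le_rfl (h i).1⟩

/-- `z ⊆ z' ⇒ c − z ⊆ c − z'`. [cite: AlefeldHerzberger1983, Thm 10.5 (10')] -/
theorem psubV_incl_mono {z z' : IVec n} (h : Incl z z') (c : Fin n → ℝ) : Incl (psubV c z) (psubV c z') :=
  fun i => by
    simp only [psubV_fst, psubV_snd, Pi.sub_apply]
    exact ⟨sub_le_sub le_rfl (h i).2, sub_le_sub le_rfl (h i).1⟩

/-- `d(c − z) = d(z)`. [cite: AlefeldHerzberger1983, Def 10.6] -/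
theorem width_psubV (c : Fin n → ℝ) (z : IVec n) (i : Fin n) : width (psubV c z) i = width z i := by
  simp only [width, psubV_fst, psubV_snd, Pi.sub_apply]
  ring

/-- `d(x ∩ z) ≤ d(x)` ((10.11) for `x ∩ z ⊆ x`). [cite: AlefeldHerzberger1983, Def 10.6 (10.11)] -/
theorem width_inter_le_left (x z : IVec n) (i : Fin n) : width (inter x z) i ≤ width x i := by
  simp only [width, inter]
  exact sub_le_sub (min_le_left _ _) (le_max_left _ _)

/-! ## §2 The representation (10.1) of the components of `𝓥·v` -/

/-- [folklore] a convex combination of two points of `[lo, hi]` lies in `[lo, hi]`. -/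
private theorem convex_comb_mem' {lo hi a b s : ℝ} (hs : 0 ≤ s ∧ s ≤ 1) (ha : lo ≤ a ∧ a ≤ hi)
    (hb : lo ≤ b ∧ b ≤ hi) : lo ≤ (1 - s) * a + s * b ∧ (1 - s) * a + s * b ≤ hi := by
  constructor <;> nlinarith [ha.1, ha.2, hb.1, hb.2, hs.1, hs.2]

/-- **(10.1)** for a component of `𝓥·v` (`v` a point vector): every number in `(𝓥·v)_i` is `Σ_j w_j v_j` with
a point row `w`, `V̲_ij ≤ w_j ≤ V̄_ij` ("if an interval matrix is multiplied by a real vector then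
`𝓐x = {𝓐̃x | 𝓐̃ ∈ 𝓐}`").
[cite: AlefeldHerzberger1983, Ch. 10 (10.1); Ch. 19 Thm 1, proof of (9)] -/
theorem exists_row_of_mem_mulPV {V : IMatF n} (hV : MIsProper V) (v : Fin n → ℝ) (i : Fin n) {t : ℝ}
    (ht : (mulPV V v).1 i ≤ t ∧ t ≤ (mulPV V v).2 i) :
    ∃ w : Fin n → ℝ, (∀ j, V.1 i j ≤ w j ∧ w j ≤ V.2 i j) ∧ ∑ j, w j * v j = t := by
  classical
  obtain ⟨wl, hwl, hwl'⟩ : ∃ wl : Fin n → ℝ, (∀ j, V.1 i j ≤ wl j ∧ wl j ≤ V.2 i j) ∧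
      ∀ j, wl j * v j = min (V.1 i j * v j) (V.2 i j * v j) := by
    refine ⟨fun j => if V.1 i j * v j ≤ V.2 i j * v j then V.1 i j else V.2 i j, fun j => ?_, fun j => ?_⟩
    · by_cases h : V.1 i j * v j ≤ V.2 i j * v j
      · simp only [h, if_true]; exact ⟨le_rfl, hV i j⟩
      · simp only [h, if_false]; exact ⟨hV i j, le_rfl⟩
    · by_cases h : V.1 i j * v j ≤ V.2 i j * v j
      · simp only [h, if_true]; exact (min_eq_left h).symm
      · simp only [h, if_false]; exact (min_eq_right (le_of_not_ge h)).symm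
  obtain ⟨wu, hwu, hwu'⟩ : ∃ wu : Fin n → ℝ, (∀ j, V.1 i j ≤ wu j ∧ wu j ≤ V.2 i j) ∧
      ∀ j, wu j * v j = max (V.1 i j * v j) (V.2 i j * v j) := by
    refine ⟨fun j => if V.1 i j * v j ≤ V.2 i j * v j then V.2 i j else V.1 i j, fun j => ?_, fun j => ?_⟩
    · by_cases h : V.1 i j * v j ≤ V.2 i j * v j
      · simp only [h, if_true]; exact ⟨hV i j, le_rfl⟩
      · simp only [h, if_false]; exact ⟨le_rfl, hV i j⟩
    · by_cases h : V.1 i j * v j ≤ V.2 i j * v j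
      · simp only [h, if_true]; exact (max_eq_right h).symm
      · simp only [h, if_false]; exact (max_eq_left (le_of_not_ge h)).symm
  have hSl : ∑ j, wl j * v j = (mulPV V v).1 i := by
    rw [mulPV_fst]; exact Finset.sum_congr rfl fun j _ => hwl' j
  have hSu : ∑ j, wu j * v j = (mulPV V v).2 i := by
    rw [mulPV_snd]; exact Finset.sum_congr rfl fun j _ => hwu' j
  obtain ⟨s, hs0, hs1, hs⟩ : ∃ s : ℝ, 0 ≤ s ∧ s ≤ 1 ∧ (1 - s) * (mulPV V v).1 i + s * (mulPV V v).2 i = t := by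
    by_cases heq : (mulPV V v).1 i = (mulPV V v).2 i
    · refine ⟨0, le_rfl, zero_le_one, ?_⟩
      have : t = (mulPV V v).1 i := le_antisymm (heq ▸ ht.2) ht.1
      rw [this]; ring
    · have hlt : (mulPV V v).1 i < (mulPV V v).2 i := lt_of_le_of_ne (ht.1.trans ht.2) heq
      have hpos : 0 < (mulPV V v).2 i - (mulPV V v).1 i := sub_pos.2 hlt
      refine ⟨(t - (mulPV V v).1 i) / ((mulPV V v).2 i - (mulPV V v).1 i),
        div_nonneg (sub_nonneg.2 ht.1) hpos.le, (div_le_one hpos).2 (sub_le_sub ht.2 le_rfl), ?_⟩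
      field_simp
      ring
  refine ⟨fun j => (1 - s) * wl j + s * wu j, fun j => convex_comb_mem' ⟨hs0, hs1⟩ (hwl j) (hwu j), ?_⟩
  calc ∑ j, ((1 - s) * wl j + s * wu j) * v j
      = (1 - s) * ∑ j, wl j * v j + s * ∑ j, wu j * v j := by
        rw [Finset.mul_sum, Finset.mul_sum, ← Finset.sum_add_distrib]
        exact Finset.sum_congr rfl fun j _ => by ring
    _ = t := by rw [hSl, hSu, hs]

/-- Row-wise form of (10.1): if `0 ∈ 𝓥·v` then `𝓥̃v = 0` for some matrix `𝓥̃ ∈ 𝓥` ("we therefore obtain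
`0 = 𝓥̃·f(m(x))`").
[cite: AlefeldHerzberger1983, Ch. 10 (10.1); Ch. 19 Thm 1, proof of (9)] -/
theorem exists_mmem_mulVec_eq_zero {V : IMatF n} (hV : MIsProper V) (v : Fin n → ℝ)
    (h0 : ∀ i, (mulPV V v).1 i ≤ 0 ∧ 0 ≤ (mulPV V v).2 i) :
    ∃ P : Matrix (Fin n) (Fin n) ℝ, MMem P V ∧ P.mulVec v = 0 := by
  choose w hw hw0 using fun i => exists_row_of_mem_mulPV hV v i (t := 0) (h0 i)
  refine ⟨Matrix.of fun i j => w i j, fun i j => hw i j, funext fun i => ?_⟩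
  simp only [Matrix.mulVec, dotProduct, Matrix.of_apply, Pi.zero_apply]
  exact hw0 i

/-! ## §3 The methods (7) and (12) -/

/-- The braces of (7)/(12): `m(x) − 𝓥 f(m(x))`. [cite: AlefeldHerzberger1983, Ch. 19 (7), (12)] -/
def ncore (f : (Fin n → ℝ) → (Fin n → ℝ)) (V : IMatF n) (x : IVec n) : IVec n :=
  psubV (vmid x) (mulPV V (f (vmid x)))

/-- The iterates of (12): `x⁽ᵏ⁺¹⁾ = {m(x⁽ᵏ⁾) − 𝓥⁽ᵏ⁾ f(m(x⁽ᵏ⁾))} ∩ x⁽ᵏ⁾`; (7) is the case of a constant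
sequence `𝓥⁽ᵏ⁾ = 𝓥`. [cite: AlefeldHerzberger1983, Ch. 19 (7), (12)] -/
def seqX (f : (Fin n → ℝ) → (Fin n → ℝ)) (Vs : ℕ → IMatF n) (x0 : IVec n) : ℕ → IVec n
  | 0 => x0
  | k + 1 => inter (ncore f (Vs k) (seqX f Vs x0 k)) (seqX f Vs x0 k)

/-- [cite: AlefeldHerzberger1983, Ch. 19 (12)] -/
@[simp] theorem seqX_zero (f : (Fin n → ℝ) → (Fin n → ℝ)) (Vs : ℕ → IMatF n) (x0 : IVec n) :
    seqX f Vs x0 0 = x0 := rfl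

/-- [cite: AlefeldHerzberger1983, Ch. 19 (12)] -/
theorem seqX_succ (f : (Fin n → ℝ) → (Fin n → ℝ)) (Vs : ℕ → IMatF n) (x0 : IVec n) (k : ℕ) :
    seqX f Vs x0 (k + 1) = inter (ncore f (Vs k) (seqX f Vs x0 k)) (seqX f Vs x0 k) := rfl

/-- The method (7) is the iteration with intersection `x ↦ {m(x) − 𝓥 f(m(x))} ∩ x` of a fixed map, i.e.
`interStep (ncore f 𝓥)` iterated. [cite: AlefeldHerzberger1983, Ch. 19 (7)] -/
theorem seqX_const (f : (Fin n → ℝ) → (Fin n → ℝ)) (V : IMatF n) (x0 : IVec n) :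
    ∀ k, seqX f (fun _ => V) x0 k = (interStep (ncore f V))^[k] x0
  | 0 => rfl
  | k + 1 => by
    rw [seqX_succ, seqX_const f V x0 k, Function.iterate_succ_apply']
    rfl

/-- The iterates are nested: `x⁽ᵏ⁺¹⁾ ⊆ x⁽ᵏ⁾`. [cite: AlefeldHerzberger1983, Ch. 19 (7)] -/
theorem seqX_succ_incl (f : (Fin n → ℝ) → (Fin n → ℝ)) (Vs : ℕ → IMatF n) (x0 : IVec n) (k : ℕ) :
    Incl (seqX f Vs x0 (k + 1)) (seqX f Vs x0 k) := by
  rw [seqX_succ]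
  exact inter_incl_right _ _

/-- `x⁽ᵏ⁺¹⁾ ⊆ m(x⁽ᵏ⁾) − 𝓥⁽ᵏ⁾ f(m(x⁽ᵏ⁾))`. [cite: AlefeldHerzberger1983, Ch. 19 (7), (12)] -/
theorem seqX_succ_incl_ncore (f : (Fin n → ℝ) → (Fin n → ℝ)) (Vs : ℕ → IMatF n) (x0 : IVec n) (k : ℕ) :
    Incl (seqX f Vs x0 (k + 1)) (ncore f (Vs k) (seqX f Vs x0 k)) := by
  rw [seqX_succ]
  exact inter_incl_left _ _

/-- `x⁽ᵏ⁾ ⊆ x⁽⁰⁾`. [cite: AlefeldHerzberger1983, Ch. 19 (7)] -/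
theorem seqX_incl_zero (f : (Fin n → ℝ) → (Fin n → ℝ)) (Vs : ℕ → IMatF n) (x0 : IVec n) :
    ∀ k, Incl (seqX f Vs x0 k) x0
  | 0 => incl_rfl _
  | k + 1 => incl_trans (seqX_succ_incl f Vs x0 k) (seqX_incl_zero f Vs x0 k)

/-- Inclusion monotonicity of the braces in the matrix: `𝓥 ⊆ 𝓦 ⇒ m(x) − 𝓥 f(m(x)) ⊆ m(x) − 𝓦 f(m(x))`.
[cite: AlefeldHerzberger1983, Thm 10.5 (10'); Ch. 19 Thm 2, proof] -/
theorem ncore_incl_of_mincl (f : (Fin n → ℝ) → (Fin n → ℝ)) {V W : IMatF n} (h : MIncl V W) (hV : MIsProper V)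
    (x : IVec n) : Incl (ncore f V x) (ncore f W x) :=
  psubV_incl_mono (mulPV_incl_of_mincl h hV _) _

/-- The first estimate in the proof of (13): `d(x⁽ᵏ⁺¹⁾) ≤ d(m(x⁽ᵏ⁾) − 𝓥⁽ᵏ⁾f(m(x⁽ᵏ⁾))) = d(𝓥⁽ᵏ⁾)|f(m(x⁽ᵏ⁾))|`.
[cite: AlefeldHerzberger1983, Ch. 19 Thm 2, proof of (13)] -/
theorem width_seqX_succ_le (f : (Fin n → ℝ) → (Fin n → ℝ)) {Vs : ℕ → IMatF n} (x0 : IVec n) {k : ℕ}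
    (hVk : MIsProper (Vs k)) (i : Fin n) :
    width (seqX f Vs x0 (k + 1)) i ≤ ∑ j, ((Vs k).2 i j - (Vs k).1 i j) * |f (vmid (seqX f Vs x0 k)) j| := by
  rw [seqX_succ]
  calc width (inter (ncore f (Vs k) (seqX f Vs x0 k)) (seqX f Vs x0 k)) i
        ≤ width (ncore f (Vs k) (seqX f Vs x0 k)) i := width_inter_le_left _ _ i
    _ = ∑ j, ((Vs k).2 i j - (Vs k).1 i j) * |f (vmid (seqX f Vs x0 k)) j| := by
        show width (psubV _ _) i = _
        rw [width_psubV, width_mulPV hVk]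

/-! ## §4 Theorems 1 and 2, part (8): every iterate contains the zero `y` -/

/-- The step of the proof of (8): if `f(m(x)) = 𝓙(m(x) − y)` with `𝓙` nonsingular and `𝓙⁻¹ ∈ 𝓥`, then
`y = m(x) − 𝓙⁻¹f(m(x)) ∈ m(x) − 𝓥 f(m(x))` by (10.10'). [cite: AlefeldHerzberger1983, Ch. 19 Thm 1, proof of (8)] -/
theorem zero_pmem_ncore {f : (Fin n → ℝ) → (Fin n → ℝ)} {J : Matrix (Fin n) (Fin n) ℝ} {y : Fin n → ℝ}
    {V : IMatF n} {x : IVec n} (hJ : f (vmid x) = J.mulVec (vmid x - y)) (hreg : IsUnit J.det)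
    (hV : MMem J⁻¹ V) : PMem y (ncore f V x) := by
  have hy : y = vmid x - J⁻¹.mulVec (f (vmid x)) := by
    rw [hJ, Matrix.mulVec_mulVec, Matrix.nonsing_inv_mul J hreg, Matrix.one_mulVec, sub_sub_cancel]
  rw [hy]
  exact sub_pmem_psubV (mulVec_pmem_mulPV hV _) _

/-- **Theorem 2 (8)** (method (12)): if `y ∈ x⁽⁰⁾`, (3) holds on `x⁽⁰⁾` with nonsingular `𝓙(x)`, and
`𝓙(x)⁻¹ ∈ 𝓥⁽ᵏ⁾` for `x ∈ x⁽ᵏ⁾`, then every iterate `x⁽ᵏ⁾` contains `y`.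
[cite: AlefeldHerzberger1983, Ch. 19 Thm 2 (8)] -/
theorem thm19_2_zero_pmem {f : (Fin n → ℝ) → (Fin n → ℝ)} {J : (Fin n → ℝ) → Matrix (Fin n) (Fin n) ℝ}
    {y : Fin n → ℝ} {x0 : IVec n} (hy : PMem y x0) (hJ : ∀ x, PMem x x0 → f x = (J x).mulVec (x - y))
    (hJreg : ∀ x, PMem x x0 → IsUnit (J x).det) {Vs : ℕ → IMatF n}
    (hV : ∀ k x, PMem x (seqX f Vs x0 k) → MMem (J x)⁻¹ (Vs k)) : ∀ k, PMem y (seqX f Vs x0 k)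
  | 0 => hy
  | k + 1 => by
    have ih := thm19_2_zero_pmem hy hJ hJreg hV k
    have hm : PMem (vmid (seqX f Vs x0 k)) (seqX f Vs x0 k) := vmid_pmem (isProper_of_pmem ih)
    have hm0 : PMem (vmid (seqX f Vs x0 k)) x0 := pmem_of_pmem_of_incl hm (seqX_incl_zero f Vs x0 k)
    rw [seqX_succ]
    exact pmem_inter (zero_pmem_ncore (hJ _ hm0) (hJreg _ hm0) (hV k _ hm)) ih

/-- **Theorem 1 (8)** (method (7)): with `𝓙(x)⁻¹ ∈ 𝓥` for all `x ∈ x⁽⁰⁾`, each interval vector `x⁽ᵏ⁾`,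
`k ≥ 0`, contains the zero `y`. [cite: AlefeldHerzberger1983, Ch. 19 Thm 1 (8)] -/
theorem thm19_1_zero_pmem {f : (Fin n → ℝ) → (Fin n → ℝ)} {J : (Fin n → ℝ) → Matrix (Fin n) (Fin n) ℝ}
    {y : Fin n → ℝ} {x0 : IVec n} (hy : PMem y x0) (hJ : ∀ x, PMem x x0 → f x = (J x).mulVec (x - y))
    (hJreg : ∀ x, PMem x x0 → IsUnit (J x).det) {V : IMatF n} (hV : ∀ x, PMem x x0 → MMem (J x)⁻¹ V)
    (k : ℕ) : PMem y ((interStep (ncore f V))^[k] x0) := by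
  rw [← seqX_const]
  exact thm19_2_zero_pmem hy hJ hJreg (fun k x hx => hV x (pmem_of_pmem_of_incl hx (seqX_incl_zero _ _ _ k))) k

/-! ## §5 Continuity of the iteration (7) -/

/-- [cite: AlefeldHerzberger1983, Ch. 18 (1)] -/
theorem continuous_vmid : Continuous (vmid : IVec n → Fin n → ℝ) :=
  continuous_pi fun i =>
    (((continuous_apply i).comp continuous_fst).add ((continuous_apply i).comp continuous_snd)).div_const _

/-- [cite: AlefeldHerzberger1983, Ch. 10 (matrix operations)] -/
theorem continuous_mulPV (V : IMatF n) : Continuous (mulPV V : (Fin n → ℝ) → IVec n) :=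
  (continuous_pi fun _ => continuous_finsetSum _ fun j _ =>
      ((continuous_apply j).const_mul _).min ((continuous_apply j).const_mul _)).prodMk
    (continuous_pi fun _ => continuous_finsetSum _ fun j _ =>
      ((continuous_apply j).const_mul _).max ((continuous_apply j).const_mul _))

/-- "From the continuity of iteration (7)": `x ↦ m(x) − 𝓥 f(m(x))` is continuous when `f` is.
[cite: AlefeldHerzberger1983, Ch. 19 Thm 1, proof of (9)] -/
theorem continuous_ncore {f : (Fin n → ℝ) → (Fin n → ℝ)} (hf : Continuous f) (V : IMatF n) :
    Continuous (ncore f V : IVec n → IVec n) := by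
  have h1 : Continuous fun x : IVec n => mulPV V (f (vmid x)) := (continuous_mulPV V).comp (hf.comp continuous_vmid)
  exact (continuous_vmid.sub (continuous_snd.comp h1)).prodMk (continuous_vmid.sub (continuous_fst.comp h1))

/-- [folklore] limits respect `u⁽ᵏ⁺¹⁾ ⊆ v⁽ᵏ⁾`: if `u⁽ᵏ⁾ → x`, `v⁽ᵏ⁾ → z` then `x ⊆ z`. -/
private theorem incl_of_seqLim_succ {u v : ℕ → IVec n} {x z : IVec n} (hu : SeqLim u x) (hv : SeqLim v z)
    (h : ∀ k, Incl (u (k + 1)) (v k)) : Incl x z := fun i =>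
  ⟨le_of_tendsto_of_tendsto' (hv i).1 ((hu i).1.comp (tendsto_add_atTop_nat 1)) fun k => (h k i).1,
    le_of_tendsto_of_tendsto' ((hu i).2.comp (tendsto_add_atTop_nat 1)) (hv i).2 fun k => (h k i).2⟩

/-! ## §6 Theorems 1 and 2, part (9): convergence to `y` -/

/-- The heart of the proof of (9): if `m(x) ∈ m(x) − 𝓥 f(m(x))` for a genuine `𝓥` all of whose matrices
are nonsingular, then `0 ∈ 𝓥 f(m(x))`, so `0 = 𝓥̃ f(m(x))` with `𝓥̃ ∈ 𝓥` by (10.1), `f(m(x)) = 0`, and by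
(3) `m(x) = y`. [cite: AlefeldHerzberger1983, Ch. 19 Thm 1, proof of (9)] -/
theorem vmid_eq_of_pmem_ncore {f : (Fin n → ℝ) → (Fin n → ℝ)} {J : Matrix (Fin n) (Fin n) ℝ}
    {y : Fin n → ℝ} {V : IMatF n} {x : IVec n} (hJ : f (vmid x) = J.mulVec (vmid x - y))
    (hJreg : IsUnit J.det) (hV : MIsProper V) (hreg : ∀ P : Matrix (Fin n) (Fin n) ℝ, MMem P V → IsUnit P.det)
    (h : PMem (vmid x) (ncore f V x)) : vmid x = y := by
  have h0 : ∀ i, (mulPV V (f (vmid x))).1 i ≤ 0 ∧ 0 ≤ (mulPV V (f (vmid x))).2 i := fun i => by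
    have h1 := (h i).1
    have h2 := (h i).2
    simp only [ncore, psubV_fst, psubV_snd, Pi.sub_apply] at h1 h2
    constructor <;> linarith
  obtain ⟨P, hP, hP0⟩ := exists_mmem_mulVec_eq_zero hV _ h0
  have hf0 : f (vmid x) = 0 := Matrix.eq_zero_of_mulVec_eq_zero (hreg P hP).ne_zero hP0
  rw [hJ] at hf0
  exact sub_eq_zero.1 (Matrix.eq_zero_of_mulVec_eq_zero hJreg.ne_zero hf0)

/-- Remark after Theorem 1: if `m(x⁽ᵏ⁾) ≠ y` then `m(x⁽ᵏ⁾) ∉ x⁽ᵏ⁺¹⁾` ("at least one component of the width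
`d(x⁽ᵏ⁾)` is more than halved"), here for (12) with `𝓥⁽ᵏ⁾ ⊆ 𝓥⁽⁰⁾` and all `𝓥̃ ∈ 𝓥⁽⁰⁾` nonsingular.
[cite: AlefeldHerzberger1983, Ch. 19, remark after Thm 1] -/
theorem vmid_not_pmem_succ {f : (Fin n → ℝ) → (Fin n → ℝ)} {J : (Fin n → ℝ) → Matrix (Fin n) (Fin n) ℝ}
    {y : Fin n → ℝ} {x0 : IVec n} (hy : PMem y x0) (hJ : ∀ x, PMem x x0 → f x = (J x).mulVec (x - y))
    (hJreg : ∀ x, PMem x x0 → IsUnit (J x).det) {Vs : ℕ → IMatF n}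
    (hV : ∀ k x, PMem x (seqX f Vs x0 k) → MMem (J x)⁻¹ (Vs k)) (hVsub : ∀ k, MIncl (Vs k) (Vs 0))
    (hreg : ∀ P : Matrix (Fin n) (Fin n) ℝ, MMem P (Vs 0) → IsUnit P.det) {k : ℕ}
    (hne : vmid (seqX f Vs x0 k) ≠ y) : ¬ PMem (vmid (seqX f Vs x0 k)) (seqX f Vs x0 (k + 1)) := by
  intro hm
  have hyk := thm19_2_zero_pmem hy hJ hJreg hV k
  have hm0 : PMem (vmid (seqX f Vs x0 k)) x0 :=
    pmem_of_pmem_of_incl (vmid_pmem (isProper_of_pmem hyk)) (seqX_incl_zero f Vs x0 k)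
  have hVk : MIsProper (Vs k) := mIsProper_of_mmem (hV k y hyk)
  exact hne (vmid_eq_of_pmem_ncore (hJ _ hm0) (hJreg _ hm0) hVk
    (fun P hP => hreg P (mmem_of_mmem_of_mincl hP (hVsub k)))
    (pmem_of_pmem_of_incl hm (seqX_succ_incl_ncore f Vs x0 k)))

/-- **Theorem 2 (9)** (method (12)): if moreover `f` is continuous, `𝓥⁽ᵏ⁾ ⊆ 𝓥⁽⁰⁾` and every matrix
`𝓥̃ ∈ 𝓥⁽⁰⁾` is nonsingular, then `lim x⁽ᵏ⁾ = y`. [cite: AlefeldHerzberger1983, Ch. 19 Thm 2 (9)] -/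
theorem thm19_2_lim {f : (Fin n → ℝ) → (Fin n → ℝ)} (hf : Continuous f)
    {J : (Fin n → ℝ) → Matrix (Fin n) (Fin n) ℝ} {y : Fin n → ℝ} {x0 : IVec n} (hy : PMem y x0)
    (hJ : ∀ x, PMem x x0 → f x = (J x).mulVec (x - y)) (hJreg : ∀ x, PMem x x0 → IsUnit (J x).det)
    {Vs : ℕ → IMatF n} (hV : ∀ k x, PMem x (seqX f Vs x0 k) → MMem (J x)⁻¹ (Vs k))
    (hVsub : ∀ k, MIncl (Vs k) (Vs 0)) (hreg : ∀ P : Matrix (Fin n) (Fin n) ℝ, MMem P (Vs 0) → IsUnit P.det) :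
    SeqLim (seqX f Vs x0) (y, y) := by
  have hmem : ∀ k, PMem y (seqX f Vs x0 k) := thm19_2_zero_pmem hy hJ hJreg hV
  have hprop : ∀ k, IsProper (seqX f Vs x0 k) := fun k => isProper_of_pmem (hmem k)
  -- Cor. 10.8: the nested iterates converge to some `x ∋ y`, `x ⊆ x⁽⁰⁾`
  obtain ⟨x, hx, hxp, hxk, hxmax⟩ := cor10_8 (seqX_succ_incl f Vs x0) hprop
  have hyx : PMem y x := (pmem_iff_incl _ _).2 (hxmax (y, y) fun k => (pmem_iff_incl _ _).1 (hmem k))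
  have hx0 : Incl x x0 := hxk 0
  -- `x⁽ᵏ⁺¹⁾ ⊆ m(x⁽ᵏ⁾) − 𝓥⁽⁰⁾ f(m(x⁽ᵏ⁾))`; pass to the limit by continuity
  have hsub : ∀ k, Incl (seqX f Vs x0 (k + 1)) (ncore f (Vs 0) (seqX f Vs x0 k)) := fun k =>
    incl_trans (seqX_succ_incl_ncore f Vs x0 k)
      (ncore_incl_of_mincl f (hVsub k) (mIsProper_of_mmem (hV k y (hmem k))) _)
  have hxg : Incl x (ncore f (Vs 0) x) :=
    incl_of_seqLim_succ hx (seqLim_map (continuous_ncore hf (Vs 0)) hx) hsub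
  -- `m(x) ∈ x ⊆ m(x) − 𝓥⁽⁰⁾ f(m(x))`, hence `m(x) = y`
  have hm : PMem (vmid x) x := vmid_pmem hxp
  have hm0 : PMem (vmid x) x0 := pmem_of_pmem_of_incl hm hx0
  have hmy : vmid x = y := vmid_eq_of_pmem_ncore (hJ _ hm0) (hJreg _ hm0) (mIsProper_of_mmem (hV 0 y hy)) hreg
    (pmem_of_pmem_of_incl hm hxg)
  -- `f(y) = 0`, so `m(x) − 𝓥⁽⁰⁾ f(m(x)) = [y, y]` and `x = [y, y]`
  have hfy : f y = 0 := by rw [hJ y hy, sub_self, Matrix.mulVec_zero]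
  have hg : ncore f (Vs 0) x = (y, y) := by
    show psubV (vmid x) (mulPV (Vs 0) (f (vmid x))) = (y, y)
    rw [hmy, hfy, mulPV_zero]
    exact Prod.ext (sub_zero y) (sub_zero y)
  rw [hg] at hxg
  have hxy : x = (y, y) :=
    Prod.ext (funext fun i => le_antisymm (hmy ▸ (hm i).1) (hxg i).1)
      (funext fun i => le_antisymm (hxg i).2 (hmy ▸ (hm i).2))
  rw [hxy] at hx
  exact hx

/-- **Theorem 1 (9)** (method (7)): if `f` is continuous, `𝓙(x)⁻¹ ∈ 𝓥` for `x ∈ x⁽⁰⁾` and each matrix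
`𝓥̃ ∈ 𝓥` is nonsingular, then `lim x⁽ᵏ⁾ = y`. [cite: AlefeldHerzberger1983, Ch. 19 Thm 1 (9)] -/
theorem thm19_1_lim {f : (Fin n → ℝ) → (Fin n → ℝ)} (hf : Continuous f)
    {J : (Fin n → ℝ) → Matrix (Fin n) (Fin n) ℝ} {y : Fin n → ℝ} {x0 : IVec n} (hy : PMem y x0)
    (hJ : ∀ x, PMem x x0 → f x = (J x).mulVec (x - y)) (hJreg : ∀ x, PMem x x0 → IsUnit (J x).det)
    {V : IMatF n} (hV : ∀ x, PMem x x0 → MMem (J x)⁻¹ V)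
    (hreg : ∀ P : Matrix (Fin n) (Fin n) ℝ, MMem P V → IsUnit P.det) :
    SeqLim (fun k => (interStep (ncore f V))^[k] x0) (y, y) := by
  have h := thm19_2_lim hf hy hJ hJreg (Vs := fun _ => V)
    (fun k x hx => hV x (pmem_of_pmem_of_incl hx (seqX_incl_zero _ _ _ k))) (fun _ _ _ => ⟨le_rfl, le_rfl⟩) hreg
  intro i
  simpa only [seqX_const] using h i

/-- Remark after Theorem 1 for the method (7): `m(x⁽ᵏ⁾) ≠ y ⇒ m(x⁽ᵏ⁾) ∉ x⁽ᵏ⁺¹⁾`.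
[cite: AlefeldHerzberger1983, Ch. 19, remark after Thm 1] -/
theorem thm19_1_vmid_not_pmem_succ {f : (Fin n → ℝ) → (Fin n → ℝ)} {J : (Fin n → ℝ) → Matrix (Fin n) (Fin n) ℝ}
    {y : Fin n → ℝ} {x0 : IVec n} (hy : PMem y x0) (hJ : ∀ x, PMem x x0 → f x = (J x).mulVec (x - y))
    (hJreg : ∀ x, PMem x x0 → IsUnit (J x).det) {V : IMatF n} (hV : ∀ x, PMem x x0 → MMem (J x)⁻¹ V)
    (hreg : ∀ P : Matrix (Fin n) (Fin n) ℝ, MMem P V → IsUnit P.det) {k : ℕ}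
    (hne : vmid ((interStep (ncore f V))^[k] x0) ≠ y) :
    ¬ PMem (vmid ((interStep (ncore f V))^[k] x0)) ((interStep (ncore f V))^[k + 1] x0) := by
  rw [← seqX_const] at hne ⊢
  rw [← seqX_const]
  exact vmid_not_pmem_succ hy hJ hJreg (Vs := fun _ => V)
    (fun k x hx => hV x (pmem_of_pmem_of_incl hx (seqX_incl_zero _ _ _ k))) (fun _ _ _ => ⟨le_rfl, le_rfl⟩)
    hreg hne

end Literature.Analysis.ValidatedNumerics.NewtonLikeIntervalIteration

end
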